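import Summits.ValiantsHypothesis.ValiantsHypothesis.Theorems.DepthWindowGrowingDial
import Summits.ValiantsHypothesis.ValiantsHypothesis.Theorems.DepthWindowHalf
import HarnessLib

/-!
# Route `DepthWindow` — the tool ceiling at slope one half and the window certificate after generation 4

Companion of `DepthWindowHalf.lean` (generation 4: the kernel rung `perHardBelowHalf p q (2p < q)` = `A_{⌊p L₃/q⌋}`,
`L₃ n := ⌊log₂⌊log₂⌊log₂ n⌋⌋⌋`), `DepthWindowGrowingDial.lean` (generation 3's certificate) and `DepthWindowDial.lean`
(the dial `A_Δ` / `B_Δ`, `B_Δ ↔ (A_Δ → VH)`, top bracket `A_{⌈log₂ n⌉+1} ↔ VH`).  Decomp-valiant workshop, lens 4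
«depth-reduction / chasm axis», generation 4; authored by the lens seat; node record `NODE-v4.md` in
`run/shared/lean/pub/decomp-valiant/decomp-val-lens-4/`.

* §1 `lst_explicit_ceiling` — THE TOOL CEILING, KERNEL: whenever the hypotheses of the explicit-constant LST lemma
  `lst_explicit` hold at depth `Δ`, degree `d` and index `n`, already `2Δ + 4 ≤ L₃ n`.  The in-tree hardness engine
  therefore says nothing about circuits of product-depth above `L₃ n / 2 - 2`; with `perHardBelowHalf` (every slope
  `< 1/2`) the engine is SATURATED (`lst_window_saturation`): the slope interval `[0, 1/2)` of the dial is theorem, the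
  crux `PerHardLog3` sits at slope `1` (offset `+1`), and the factor two between them is exactly the depth doubling
  `Δ ↦ 2Δ` inside the LST word measure (`μ_Δ = 1/(2^{2Δ+1} - 1)`), not a constant.
* §2 the window certificate: `collapseToDepth_belowHalf_iff_vh` (`B_{⌊p L₃/q⌋} ↔ VH` for `2p < q` — the residual
  template IS the summit at every slope below one half), `perHardLog3_imp_perHardSlope` (the crux implies every slope
  rung, `p ≤ q`), `window_gap_half`, `window_certificate_half`.

Unconditional, 0 sorry, def-free; it does NOT prove VP ≠ VNP and closes no item (rung currency only).
References: [LimayeSrinivasanTavenas2025] Cor. 4, Claim 16; [ValiantSkyumBerkowitzRackoff1983]; [Burgisser2000TCS] §2;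
[BhargavDuttaSaxena2024] Thm 1.1, Rem. 1.6 (print line `κ < 0.72` with a finer measure).
-/

-- layout Summits/ValiantsHypothesis/ValiantsHypothesis forces the duplicated namespace component
set_option linter.dupNamespace false

namespace Summit.ValiantsHypothesis.ValiantsHypothesis.Theorems.DepthWindow

open MvPolynomial Real Literature.Computability.AlgebraicComplexity ArithCircuit
open Literature.Computability.AlgebraicComplexity.LSTWord
open Summit.ValiantsHypothesis.ValiantsHypothesis.Theses.DepthWindow

noncomputable section

/-! ## §1 The tool ceiling: `lst_explicit` reaches exactly slope one half -/

/-- `⌊p L / q⌋ ≤ L + 1` for `p ≤ q` (the slope-`p/q` depth sits below the crux depth `L + 1`). [folklore] -/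
theorem slope_depth_le (p q L : ℕ) (hpq : p ≤ q) : p * L / q ≤ L + 1 := by
  rcases Nat.eq_zero_or_pos q with rfl | hq
  · simp
  · calc p * L / q ≤ q * L / q := Nat.div_le_div_right (Nat.mul_le_mul_right L hpq)
      _ = L := Nat.mul_div_cancel_left L hq
      _ ≤ L + 1 := Nat.le_succ L

/-- **The tool ceiling (kernel)**: wherever the explicit-constant LST lemma `lst_explicit` applies — depth `Δ ≥ 1`,
degree `d ≥ 1` with `409600 Δ² + 1440 (Δ+1) ≤ d^{μ_Δ}` and `d ≤ μ_Δ/(30000 Δ) · log n` — the index already satisfies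
`2Δ + 4 ≤ ⌊log₂⌊log₂⌊log₂ n⌋⌋⌋` (`μ_Δ = 1/(2^{2Δ+1} - 1)` forces `d ≥ 2^{18 (2^{2Δ+1}-1)}` and `log n ≥ d`).  So this
mechanism certifies hardness of NO circuit of product-depth above `⌊log₂log₂log₂ n⌋/2 - 2`: the rung
`perHardBelowHalf` (every slope `< 1/2`) saturates it, and the crux `PerHardLog3` (slope `1`, offset `+1`) is out of
its reach by a factor of two in depth — a new measure, not a better constant, is needed there.
[cite: LimayeSrinivasanTavenas2025, Cor. 4] -/
theorem lst_explicit_ceiling {Δ d n : ℕ} (hΔ : 1 ≤ Δ) (hd1 : 1 ≤ d)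
    (hdμ : 409600 * (Δ : ℝ) ^ 2 + 1440 * ((Δ : ℝ) + 1) ≤ (d : ℝ) ^ mu Δ)
    (hdn : (d : ℝ) ≤ mu Δ / (30000 * (Δ : ℝ)) * Real.log n) :
    2 * Δ + 4 ≤ Nat.log 2 (Nat.log 2 (Nat.log 2 n)) := by
  obtain ⟨Q, hQ⟩ : ∃ Q : ℕ, Q = 2 ^ (2 * Δ + 1) := ⟨_, rfl⟩
  have hQ8 : 8 ≤ Q := by
    rw [hQ]
    calc (8 : ℕ) = 2 ^ 3 := by norm_num
      _ ≤ 2 ^ (2 * Δ + 1) := Nat.pow_le_pow_right two_pos (by omega)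
  obtain ⟨N, hN⟩ : ∃ N : ℕ, N = Q - 1 := ⟨_, rfl⟩
  have hNR : (N : ℝ) = (2 : ℝ) ^ (2 * Δ + 1) - 1 := by
    rw [hN, hQ, Nat.cast_sub Nat.one_le_two_pow]; push_cast; ring
  have hNpos : (0 : ℝ) < N := by rw [hN]; exact_mod_cast (show 0 < Q - 1 by omega)
  have hμN : mu Δ * N = 1 := by
    rw [mu_eq_inv, ← hNR]; exact one_div_mul_cancel hNpos.ne'
  have hΔR : (1 : ℝ) ≤ Δ := by exact_mod_cast hΔ
  have hd0 : (0 : ℝ) ≤ d := Nat.cast_nonneg d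
  -- `d^μ ≥ 2^18`, hence `d ≥ 2^(18 N)`
  have h18 : (2 : ℝ) ^ 18 ≤ (d : ℝ) ^ mu Δ := by
    have : (2 : ℝ) ^ 18 ≤ 409600 * (Δ : ℝ) ^ 2 + 1440 * ((Δ : ℝ) + 1) := by nlinarith
    exact this.trans hdμ
  have hdN : 2 ^ (18 * N) ≤ d := by
    have h1 : ((2 : ℝ) ^ 18) ^ N ≤ ((d : ℝ) ^ mu Δ) ^ N := pow_le_pow_left₀ (by positivity) h18 N
    have h2 : ((d : ℝ) ^ mu Δ) ^ N = d := by
      rw [← Real.rpow_natCast, ← Real.rpow_mul hd0, hμN, Real.rpow_one]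
    have h3 : ((2 : ℝ) ^ 18) ^ N = ((2 ^ (18 * N) : ℕ) : ℝ) := by push_cast; rw [pow_mul]
    have h4 : ((2 ^ (18 * N) : ℕ) : ℝ) ≤ (d : ℝ) := by rw [← h3, ← h2]; exact h1
    exact_mod_cast h4
  -- `log n ≥ d`, hence `2^d ≤ n`
  have hn : 0 < n := by
    rcases Nat.eq_zero_or_pos n with rfl | h
    · exfalso
      have h0 : Real.log ((0 : ℕ) : ℝ) = 0 := by simp
      rw [h0, mul_zero] at hdn
      have : (1 : ℝ) ≤ d := by exact_mod_cast hd1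
      linarith
    · exact h
  have hlogn : (d : ℝ) ≤ Real.log n := by
    have hcoef : mu Δ / (30000 * (Δ : ℝ)) ≤ 1 := by
      rw [div_le_one (by positivity)]; linarith [mu_le_one Δ]
    have hl0 : 0 ≤ Real.log n := Real.log_natCast_nonneg n
    calc (d : ℝ) ≤ mu Δ / (30000 * (Δ : ℝ)) * Real.log n := hdn
      _ ≤ 1 * Real.log n := mul_le_mul_of_nonneg_right hcoef hl0
      _ = Real.log n := one_mul _
  have h2d : 2 ^ d ≤ n := by
    have hnR : (0 : ℝ) < n := by exact_mod_cast hn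
    have hl2 : Real.log 2 ≤ 1 := by have := Real.log_two_lt_d9; linarith
    have h1 : (d : ℝ) * Real.log 2 ≤ Real.log n := (mul_le_of_le_one_right hd0 hl2).trans hlogn
    have h2 : (2 : ℝ) ^ d ≤ n := (Real.pow_le_iff_le_log two_pos hnR).2 h1
    exact_mod_cast h2
  -- read off the three logarithms
  have hlog1 : d ≤ Nat.log 2 n := Nat.le_log_of_pow_le one_lt_two h2d
  have hlog2 : 18 * N ≤ Nat.log 2 (Nat.log 2 n) := Nat.le_log_of_pow_le one_lt_two (hdN.trans hlog1)
  have hpow : 2 ^ (2 * Δ + 4) ≤ 18 * N := by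
    have h8 : 2 ^ (2 * Δ + 4) = 2 ^ (2 * Δ + 1) * 8 := by
      rw [show 2 * Δ + 4 = (2 * Δ + 1) + 3 by omega, pow_add]; norm_num
    rw [h8, ← hQ]; omega
  exact Nat.le_log_of_pow_le one_lt_two (hpow.trans hlog2)

/-- **Saturation at one half** (rung and ceiling side by side): the permanent is hard at every slope `p/q < 1/2`
(`perHardBelowHalf`), and the explicit LST lemma that proves it is silent above slope `1/2`
(`lst_explicit_ceiling`). [cite: LimayeSrinivasanTavenas2025, Cor. 4] -/
theorem lst_window_saturation :
    (∀ p q : ℕ, 2 * p < q → ¬ ∃ c : ℕ, ∀ n : ℕ, ∃ C : ArithCircuit ℂ (Fin n × Fin n),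
        C.Computes (perPoly (Fin n) ℂ) ∧ C.productDepth ≤ p * Nat.log 2 (Nat.log 2 (Nat.log 2 n)) / q ∧
          C.edgeSize ≤ n ^ c + c) ∧
    (∀ Δ d n : ℕ, 1 ≤ Δ → 1 ≤ d → 409600 * (Δ : ℝ) ^ 2 + 1440 * ((Δ : ℝ) + 1) ≤ (d : ℝ) ^ mu Δ →
        (d : ℝ) ≤ mu Δ / (30000 * (Δ : ℝ)) * Real.log n → 2 * Δ + 4 ≤ Nat.log 2 (Nat.log 2 (Nat.log 2 n))) :=
  ⟨fun p q h => perHardBelowHalf p q h, fun _ _ _ h1 h2 h3 h4 => lst_explicit_ceiling h1 h2 h3 h4⟩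

/-! ## §2 The window certificate after the below-one-half rung -/

/-- **Bottom bracket at every slope below one half (kernel iff)**: `B_{⌊p L₃/q⌋} ↔ VH` for `2p < q` — under
`VP = VNP` the permanent gets polynomial-wire circuits of product-depth `⌊p ⌊log₂log₂log₂ n⌋ / q⌋` if and only if
Valiant's hypothesis holds (from `perHardBelowHalf` and `collapseToDepth_iff_residual`).
[cite: LimayeSrinivasanTavenas2025, Cor. 4] -/
theorem collapseToDepth_belowHalf_iff_vh (p q : ℕ) (hpq : 2 * p < q) :
    (VP ℂ = VNP ℂ → ∃ c : ℕ, ∀ n : ℕ, ∃ C : ArithCircuit ℂ (Fin n × Fin n),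
      C.Computes (perPoly (Fin n) ℂ) ∧ C.productDepth ≤ p * Nat.log 2 (Nat.log 2 (Nat.log 2 n)) / q ∧
        C.edgeSize ≤ n ^ c + c) ↔
    _root_.ValiantsHypothesis :=
  ⟨fun hB => (collapseToDepth_iff_residual fun n => p * Nat.log 2 (Nat.log 2 (Nat.log 2 n)) / q).mp hB
      (perHardBelowHalf p q hpq),
    fun h => collapseToDepth_of_vh (fun n => p * Nat.log 2 (Nat.log 2 (Nat.log 2 n)) / q) h⟩

/-- The crux `PerHardLog3` (= `A_{L₃+1}`) implies every slope rung `A_{⌊p L₃/q⌋}`, `p ≤ q` (so each rung is the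
WEAKER statement; the rungs with `2p < q` are theorems, `perHardBelowHalf`). [folklore] -/
theorem perHardLog3_imp_perHardSlope (p q : ℕ) (hpq : p ≤ q) (hA : PerHardLog3) :
    ¬ ∃ c : ℕ, ∀ n : ℕ, ∃ C : ArithCircuit ℂ (Fin n × Fin n),
      C.Computes (perPoly (Fin n) ℂ) ∧ C.productDepth ≤ p * Nat.log 2 (Nat.log 2 (Nat.log 2 n)) / q ∧
        C.edgeSize ≤ n ^ c + c :=
  perHardAtDepth_anti (Δ := fun n => p * Nat.log 2 (Nat.log 2 (Nat.log 2 n)) / q)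
    (Δ' := fun n => Nat.log 2 (Nat.log 2 (Nat.log 2 n)) + 1) (fun _ => slope_depth_le p q _ hpq) hA

/-- The lower gap of the window stays unbounded but is now a FACTOR: for `2p < q` and every `k` some `n` has
`⌊p L₃ n / q⌋ + k ≤ L₃ n + 1` (tower `n = 2^(2^(2^(qk)))`, `L₃ n = qk`). [folklore] -/
theorem window_gap_half (p q k : ℕ) (hpq : 2 * p < q) :
    ∃ n : ℕ, p * Nat.log 2 (Nat.log 2 (Nat.log 2 n)) / q + k ≤ Nat.log 2 (Nat.log 2 (Nat.log 2 n)) + 1 := by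
  refine ⟨2 ^ (2 ^ (2 ^ (q * k))), ?_⟩
  rw [log3_tower]
  have hq : 0 < q := by omega
  have h1 : p * (q * k) / q = p * k := by
    rw [show p * (q * k) = q * (p * k) by ring]; exact Nat.mul_div_cancel_left _ hq
  rw [h1]
  nlinarith

/-- **The window certificate after generation 4**: below the node, `B_{⌊p L₃/q⌋} ↔ VH` for every slope
`p/q < 1/2` (kernel); above it, `A_{⌈log₂ n⌉+1} ↔ VH` (VSBR); and `⌊p L₃ n/q⌋ ≤ L₃ n + 1 ≤ ⌈log₂ n⌉ + 1` for
every `n`.  The open window on the hardness side is the slope interval `[1/2, 1]`. [folklore] -/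
theorem window_certificate_half (p q : ℕ) (hpq : 2 * p < q) :
    ((VP ℂ = VNP ℂ → ∃ c : ℕ, ∀ n : ℕ, ∃ C : ArithCircuit ℂ (Fin n × Fin n),
        C.Computes (perPoly (Fin n) ℂ) ∧ C.productDepth ≤ p * Nat.log 2 (Nat.log 2 (Nat.log 2 n)) / q ∧
          C.edgeSize ≤ n ^ c + c) ↔
      _root_.ValiantsHypothesis) ∧
    ((¬ ∃ c : ℕ, ∀ n : ℕ, ∃ C : ArithCircuit ℂ (Fin n × Fin n),
        C.Computes (perPoly (Fin n) ℂ) ∧ C.productDepth ≤ Nat.clog 2 n + 1 ∧ C.edgeSize ≤ n ^ c + c) ↔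
      _root_.ValiantsHypothesis) ∧
    (∀ n, p * Nat.log 2 (Nat.log 2 (Nat.log 2 n)) / q ≤ Nat.log 2 (Nat.log 2 (Nat.log 2 n)) + 1 ∧
      Nat.log 2 (Nat.log 2 (Nat.log 2 n)) + 1 ≤ Nat.clog 2 n + 1) :=
  ⟨collapseToDepth_belowHalf_iff_vh p q hpq, perHardAtDepth_clog_succ_iff_vh,
    fun n => ⟨slope_depth_le p q _ (by omega), log3Depth_le_clog_succ n⟩⟩

end

end Summit.ValiantsHypothesis.ValiantsHypothesis.Theorems.DepthWindow
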